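import Literature.AnabelianGeometry.AbsoluteAnabelian.AbsTopII.DehnTwistLoopLogPointsCusp
import HarnessLib

/-!
# [AbsTopII] Prop 1.3 (viii) at the nodal datum: the «Moreover» identity `D_e ∩ D_c ∩ Π_I = I_v` for the configured pair

S. Mochizuki, *Topics in Absolute Anabelian Geometry II* [AbsTopII] (bib `MochizukiAbsTopII2013`; locators =
PDF pages of the kurims manuscript `paper:url-585b8d0ad0d9`), §1, Def 1.2 (ii) p. 10, Prop 1.3 (viii) p. 12:

> "(viii) Let `e, e'` be edges of `𝔾`.  If `D_e ∩ D_{e'} ∩ Π_I ≠ {1}`, then one of the following two [mutually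
> exclusive] properties holds: (1) `e = e'`; (2) `e` and `e'` are distinct, but abut to the same vertex `v`, and
> `D_e ∩ D_{e'} ∩ Π_𝔾 = {1}`.  Moreover, in the situation of (2), [for appropriate choices of conjugates of the
> various inertia and decomposition groups involved] we have `I_v = D_e ∩ D_{e'} ∩ Π_I`."

PROOF-ONLY file (abc-iut-L4-t6 lineage, typer of record of Prop 1.3 (viii): `DPSCIndexData.Prop_1_3_viii'`,
`InertiaGroupsScope.lean` p427207), nodal constructed-model column.  At the nodal Dehn-twist datum
`DehnTwist.dpsc i hi` (one vertex `v`, one LOOP node `e`, one cusp `c` — two DISTINCT edges abutting to the same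
vertex, i.e. situation (2) is INHABITED) the «Moreover» identity holds for the CONFIGURED representatives
`D_e = N_{Π_I}(Π_e × 1) = b^Ẑ ⋊ Ẑ` and `D_c = N_{Π_I}(Π_c × 1) = c^Ẑ ⋊ Ẑ` (abc-iut-f-069,
`normalizer_map_inl_nodeGp_eq` / `normalizer_map_inl_cuspGp_eq`): `D_e ∩ D_c ∩ Π_I = 1 ⋊ Ẑ = I_v` EXACTLY
(`DvNode_inf_DvCusp_inf_PiI_eq_Iv_dpsc`), because the two axes meet trivially, `b^Ẑ ∩ c^Ẑ = 1`
(`bAxis_inf_cAxis_eq_bot`: the `b`-exponent `ê_b` is the identity on `b^·` and trivial on the commutator axis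
`c^·`).  Hence the conclusion of the typed situation-(2) clause of `Prop_1_3_viii'` holds for the pairs `(e, c)`,
`(c, e)` at the conjugate `γ = 1` (`prop_1_3_viii'_conclusion_configured_dpsc`); its `Π_𝔾`-part for EVERY `γ`
is abc-iut-f-069's `DehnTwistLoopDecomposition` (p468661).
SCOPE (honest): the I_v-clause for an ARBITRARY `Π_𝔾`-conjugate `γ D_c γ⁻¹` — needed for `Prop_1_3_viii'` itself
at `dpsc` — is NOT proved here; it is cell gap G-L4t6g8-2 (profinite Bass–Serre for `F̂₂ ⋊ Ẑ`).  Constructed ≠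
geometric; nothing here bears on [IUTchIII] Cor 3.12.
-/

noncomputable section

open scoped Pointwise commutatorElement

namespace Literature.AnabelianGeometry.AbsoluteAnabelian.AbsTopII.DehnTwist

open Literature.AnabelianGeometry.EtaleTheta.SettingModel
open _root_.Topology

/-! ### The two axes meet trivially: `b^Ẑ ∩ c^Ẑ = 1` -/

/-- **`ê_b` kills the commutator axis**: `ê_b(c^t) = 1` (two continuous homomorphisms `Ẑ → Ẑ` agreeing on
`ι(1)`: `ê_b(η[a,b]) = [ê_b η a, ê_b η b] = 1`, `Ẑ` being commutative). [cite: MochizukiEtTh2009, §1 p.12] -/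
theorem eHatB_cPow (t : ZH) : eHatB (cPow t) = 1 := by
  have h := ZHatCompletion.monoidHom_ext_of_continuous
    (f₁ := eHatB.toMonoidHom.comp cPow.toMonoidHom) (f₂ := (1 : ZH →* ZH))
    (eHatB.continuous.comp cPow.continuous) continuous_const (by
      change eHatB (cPow (iotaZ (Multiplicative.ofAdd 1))) = 1
      rw [cPow_spec, eHatB_eta, map_commutatorElement,
        commutatorElement_eq_one_iff_mul_comm.mpr (mul_comm _ _), map_one])
  exact DFunLike.congr_fun h t

/-- **`b^Ẑ ∩ c^Ẑ = 1` in `F̂₂`**: an element `b^t = c^s` has `ê_b`-value `t = 1`.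
[cite: MochizukiAbsTopII2013, Prop 1.3 (viii) p.12] -/
theorem bAxis_inf_cAxis_eq_bot : bAxis ⊓ cAxis = ⊥ := by
  rw [eq_bot_iff]
  intro x hx
  obtain ⟨⟨t, ht⟩, ⟨s, hs⟩⟩ := Subgroup.mem_inf.mp hx
  have ht' : bPow t = x := ht
  have hs' : cPow s = x := hs
  have h1 : t = 1 := by rw [← eHatB_bPow t, ht', ← hs', eHatB_cPow]
  rw [Subgroup.mem_bot, ← ht', h1, map_one]

/-! ### `D_e ∩ D_c = 1 ⋊ Ẑ` in `Π_I = F̂₂ ⋊_{shear^i} Ẑ` -/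

variable (i : ℕ)

/-- **`N(Π_e × 1) ∩ N(Π_c × 1) = 1 ⋊ Ẑ`**: `(b^Ẑ ⋊ Ẑ) ∩ (c^Ẑ ⋊ Ẑ) = (b^Ẑ ∩ c^Ẑ) ⋊ Ẑ = 1 ⋊ Ẑ`.
[cite: MochizukiAbsTopII2013, Prop 1.3 (viii) p.12] -/
theorem normalizer_node_inf_normalizer_cusp_eq_range_inr :
    Subgroup.normalizer ((nodeGp.map (SemidirectProduct.inl : F₂hatT →* Ext i) : Subgroup (Ext i)) : Set (Ext i)) ⊓
        Subgroup.normalizer ((cuspGp.map (SemidirectProduct.inl : F₂hatT →* Ext i) : Subgroup (Ext i)) :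
          Set (Ext i)) =
      (SemidirectProduct.inr : ZH →* Ext i).range := by
  rw [normalizer_map_inl_nodeGp_eq, normalizer_map_inl_cuspGp_eq]
  refine le_antisymm ?_ (le_inf le_sup_right le_sup_right)
  intro x hx
  obtain ⟨hb, hc⟩ := Subgroup.mem_inf.mp hx
  rw [mem_map_inl_sup_range_inr_iff (shearPow_mem_nodeGp_of_mem i)] at hb
  rw [mem_map_inl_sup_range_inr_iff (shearPow_mem_cuspGp_of_mem i), cuspGp_eq_cAxis] at hc
  have h1 : x.left = 1 := by
    have : x.left ∈ bAxis ⊓ cAxis := Subgroup.mem_inf.mpr ⟨hb, hc⟩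
    rwa [bAxis_inf_cAxis_eq_bot, Subgroup.mem_bot] at this
  refine ⟨x.right, ?_⟩
  conv_rhs => rw [← SemidirectProduct.inl_left_mul_inr_right x]
  rw [h1, map_one, one_mul]

/-! ### Definitional transfer to `dpsc` -/

section Dpsc

variable {i} (hi : 0 < i)

/-- **The «Moreover» identity of Prop 1.3 (viii), situation (2), at the nodal datum for the configured pair
(loop node `e`, cusp `c`): `D_e ∩ D_c ∩ Π_I = I_v`** — no hypothesis. [cite: MochizukiAbsTopII2013, Prop 1.3 (viii) p.12] -/
theorem DvNode_inf_DvCusp_inf_PiI_eq_Iv_dpsc (e : (dpsc i hi).Node) (c : (dpsc i hi).Cusp) (v : (dpsc i hi).Vert) :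
    (dpsc i hi).DvNode e ⊓ (dpsc i hi).DvCusp c ⊓ (dpsc i hi).PiI = (dpsc i hi).Iv v := by
  rw [dpsc_DvNode, dpsc_DvCusp, dpsc_PiI, inf_top_eq, Iv_dpsc_eq_range_inr_holds]
  exact normalizer_node_inf_normalizer_cusp_eq_range_inr i

/-- Situation (2) of Prop 1.3 (viii) is INHABITED at the nodal datum: the node and the cusp are distinct edges
abutting to the same vertex, and `D_e ∩ D_c ∩ Π_I ≠ 1` (it is `I_v ≅ Ẑ`). [cite: MochizukiAbsTopII2013, Prop 1.3 (viii) p.12] -/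
theorem DvNode_inf_DvCusp_inf_PiI_ne_bot_dpsc (e : (dpsc i hi).Node) (c : (dpsc i hi).Cusp) :
    (dpsc i hi).DvNode e ⊓ (dpsc i hi).DvCusp c ⊓ (dpsc i hi).PiI ≠ ⊥ := by
  intro h
  have hmem : (SemidirectProduct.inr (iotaZ (Multiplicative.ofAdd 1)) : Ext i) ∈
      (dpsc i hi).DvNode e ⊓ (dpsc i hi).DvCusp c ⊓ (dpsc i hi).PiI := by
    rw [DvNode_inf_DvCusp_inf_PiI_eq_Iv_dpsc hi e c ⟨()⟩, Iv_dpsc_eq_range_inr_holds]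
    exact ⟨_, rfl⟩
  rw [h] at hmem
  exact iotaZ_one_ne_one (SemidirectProduct.inr_injective
    ((Subgroup.mem_bot.mp hmem).trans (map_one (SemidirectProduct.inr : ZH →* Ext i)).symm))

/-- **The conclusion of the typed situation-(2) clause of `Prop_1_3_viii'` for the pair (node `e`, cusp `c`) at the
configured conjugate `γ = 1`**: `e ≠ c` as edges, both abut to `v`, `D_e ∩ D_c ∩ Π_𝔾 = 1`, and `h I_v h⁻¹ =
D_e ∩ D_c ∩ Π_I` with `h = 1 ∈ Π_𝔾`.  (For every `γ ∈ Π_𝔾` the `Π_𝔾`-part is abc-iut-f-069's p468661; the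
`I_v`-part for arbitrary `γ` is gap G-L4t6g8-2.) [cite: MochizukiAbsTopII2013, Prop 1.3 (viii) p.12] -/
theorem prop_1_3_viii'_conclusion_configured_dpsc (e : (dpsc i hi).Node) (c : (dpsc i hi).Cusp) :
    (Sum.inl e : (dpsc i hi).Edge) ≠ Sum.inr c ∧
      ∃ v : (dpsc i hi).Vert, (dpsc i hi).EdgeAbuts (Sum.inl e) v ∧ (dpsc i hi).EdgeAbuts (Sum.inr c) v ∧
        (dpsc i hi).DEdge (Sum.inl e) ⊓ MulAut.conj (1 : (dpsc i hi).PiH) • (dpsc i hi).DEdge (Sum.inr c) ⊓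
            (dpsc i hi).PiG = ⊥ ∧
        ∃ h : (dpsc i hi).PiH, h ∈ (dpsc i hi).PiG ∧
          MulAut.conj h • (dpsc i hi).Iv v =
            (dpsc i hi).DEdge (Sum.inl e) ⊓ MulAut.conj (1 : (dpsc i hi).PiH) • (dpsc i hi).DEdge (Sum.inr c) ⊓
              (dpsc i hi).PiI := by
  obtain ⟨⟨⟩⟩ := e
  obtain ⟨⟨⟩⟩ := c
  refine ⟨Sum.inl_ne_inr, ⟨()⟩, Sym2.mem_iff.mpr (Or.inl rfl), rfl, ?_, 1, Subgroup.one_mem _, ?_⟩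
  · rw [map_one, one_smul]
    change (dpsc i hi).DvNode ⟨()⟩ ⊓ (dpsc i hi).DvCusp ⟨()⟩ ⊓ (dpsc i hi).PiG = ⊥
    rw [← inf_top_eq ((dpsc i hi).DvNode ⟨()⟩ ⊓ (dpsc i hi).DvCusp ⟨()⟩), ← dpsc_PiI hi,
      DvNode_inf_DvCusp_inf_PiI_eq_Iv_dpsc hi ⟨()⟩ ⟨()⟩ ⟨()⟩]
    exact Iv_inf_PiG_dpsc_holds hi ⟨()⟩
  · simp only [map_one, one_smul]
    exact (DvNode_inf_DvCusp_inf_PiI_eq_Iv_dpsc hi ⟨()⟩ ⟨()⟩ ⟨()⟩).symm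

end Dpsc

end Literature.AnabelianGeometry.AbsoluteAnabelian.AbsTopII.DehnTwist

end
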